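import Summits.CriticalPhenomena.PercolationContinuityZ3.Theorems.PercNearOneGluingNoHeavyLowerTailKnQuestion8CoefficientwiseInGadgetCex
import Mathlib.Data.Fin.VecNotation
import HarnessLib

/-!
# CONJECTURE NC-DOWN (prim-lf-2 gen 65) is FALSE at 8 vertices — a kernel-checked witness

Support file (`--supports stmt-CriticalPhenomena-4575`, closed), prover `prim-lf-2` (gen 65).  No named facts, no sorries; standard axioms; the arithmetic is
`decide +kernel` on the two-colour edge recursion `IGCex.cwRec` of `…CoefficientwiseInGadgetCex.lean` (`2⁹` leaves).  Memo `prim-lf-2/CW-NCDOWN-gen65.md` §2, §5 (D65.2).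

Setting: uniform two-colourings `s` (red edge set) of a finite multigraph, `K s` the red cluster of the root `0`, `K(E∖s)` the blue one, `M = K s ∪ K(E∖s)`, core
`Z = K s ∩ K(E∖s)`, `T = (f(K s) − f(K(E∖s)))(g(K s) − g(K(E∖s)))` for monotone `f, g`.  CONJECTURE NC-DOWN (this seat, memo §2; `…CoefficientwiseNCDownCycle.lean`,
`…NCDownGlueRoot.lean` prove it on cycles and its closure under root gluing; exact / census-clean for every rooted graph on ≤ 7 vertices): for every predicate `D` on
pairs of vertex sets that is antitone in both arguments, `Σ_{s : D (M_s) (Z_s)} T ≥ 0`.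
IT FAILS on 8 vertices (prim-lf-2 gen 65, kit65k: 12 of the 1 259 rooted 2-connected graphs with ≤ 11 edges): `G` with edges `03 06 07 15 17 24 26 34 35`, root `0`
(degree 3), `f = pt 6`, `g = pt 7`, and the Z-antitone event "`6, 7 ∉ Z` and `Z ∖ {0}` has at most one element" (the union of the five NC* events `Z ⊆ {0,v}`, `v = 1,…,5`):
the restricted sum is `−2`.  Block sums by core: `Z = {0}`: `+32`; `Z = {0,v}`: `−8` (`v = 1,2,4,5`), `−2` (`v = 3`); all cores with ≥ 2 non-root vertices: `≥ 0`.
So every PRINCIPAL event `Z ⊆ {0,v}` has sum `≥ 24` (NC* and NO-CORE hold on this graph) but the five single-vertex-core deficits share the one trivial-core surplus: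
'deficits are paid by blocks below them in (M,Z)' (memo CW-NCA-gen63 §10, CW-NCDOWN-gen65 §2.2) is false in general — at 8 vertices the colourings with LARGER cores pay.
* `Coefficientwise.NCDownCex.ncDown_sum_eq` — the event sum is `−2`;
* `Coefficientwise.NCDownCex.not_ncDown` — hence "for every antitone `D` and all monotone `f, g`, `Σ_{D(M,Z)} T ≥ 0`" is false for this graph.
CONJECTURES NC* / NCA (principal events) and DM2 (degree-two roots) are NOT affected.
[cite: KozmaNitzan2024, Questions 8–9 (§5.5 p. 36) (context: the Question-8 pocket covariance programme)]
-/

namespace Summit.CriticalPhenomena.PercolationContinuityZ3.Theorems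

open Finset Literature.Probability.Percolation Literature.Computation.FiniteGraph

namespace Coefficientwise

namespace NCDownCex

open IGCex

/-- Edge table of the witness (8 vertices, 9 edges). -/
def EL₆ : Fin 9 → ℕ × ℕ := ![(0,3), (0,6), (0,7), (1,5), (1,7), (2,4), (2,6), (3,4), (3,5)]

/-- All entries of `EL₆` are vertices of `Fin 8`. -/
theorem hEL₆ : ∀ i, (EL₆ i).1 < 8 ∧ (EL₆ i).2 < 8 := by decide

/-- The 8-vertex graph of the witness. -/
def ends₆ : Fin 9 → Sym2 (Fin 8) := endsOf EL₆ hEL₆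

/-- All nine edges as a list (for the recursion). -/
def lE₆ : List (Fin 9) := [0, 1, 2, 3, 4, 5, 6, 7, 8]

/-- The red cluster of the root `0` as a function of the red edge set. -/
noncomputable def K₆ (s : Finset (Fin 9)) : Set (Fin 8) := openCluster (ends₆ '' (↑s : Set (Fin 9))) 0

/-- Boolean form of the event: `6, 7` not in the core and at most one of `1,…,5` in the core (`z v` = "`v` in both clusters"). -/
def condB (z : ℕ → Bool) : Bool :=
  !(z 6) && (!(z 7) && (!(z 1 && z 2) && (!(z 1 && z 3) && (!(z 1 && z 4) && (!(z 1 && z 5) && (!(z 2 && z 3) && (!(z 2 && z 4) &&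
    (!(z 2 && z 5) && (!(z 3 && z 4) && (!(z 3 && z 5) && !(z 4 && z 5)))))))))))

/-- Integer leaf of the event sum: `[event]·(r₆ − b₆)(r₇ − b₇)`. -/
def leaf₆ (lr lb : List ℕ) : ℤ :=
  leafB (condB (fun v => jl lr 0 v && jl lb 0 v)) (jl lr 0 6) (jl lb 0 6) (jl lr 0 7) (jl lb 0 7)

/-- Kernel evaluation: the event recursion of the witness is `−2`. -/
theorem cwRec₆ : cwRec leaf₆ (lE₆.map EL₆) (List.range 8) (List.range 8) = -2 := by
  decide +kernel

/-- The event as a proposition on the pair (red cluster, blue cluster). -/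
def condP (A B : Set (Fin 8)) : Prop :=
  ¬ ((6 : Fin 8) ∈ A ∧ (6 : Fin 8) ∈ B) ∧ (¬ ((7 : Fin 8) ∈ A ∧ (7 : Fin 8) ∈ B) ∧
  (¬ (((1 : Fin 8) ∈ A ∧ (1 : Fin 8) ∈ B) ∧ ((2 : Fin 8) ∈ A ∧ (2 : Fin 8) ∈ B)) ∧ (¬ (((1 : Fin 8) ∈ A ∧ (1 : Fin 8) ∈ B) ∧ ((3 : Fin 8) ∈ A ∧ (3 : Fin 8) ∈ B)) ∧
  (¬ (((1 : Fin 8) ∈ A ∧ (1 : Fin 8) ∈ B) ∧ ((4 : Fin 8) ∈ A ∧ (4 : Fin 8) ∈ B)) ∧ (¬ (((1 : Fin 8) ∈ A ∧ (1 : Fin 8) ∈ B) ∧ ((5 : Fin 8) ∈ A ∧ (5 : Fin 8) ∈ B)) ∧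
  (¬ (((2 : Fin 8) ∈ A ∧ (2 : Fin 8) ∈ B) ∧ ((3 : Fin 8) ∈ A ∧ (3 : Fin 8) ∈ B)) ∧ (¬ (((2 : Fin 8) ∈ A ∧ (2 : Fin 8) ∈ B) ∧ ((4 : Fin 8) ∈ A ∧ (4 : Fin 8) ∈ B)) ∧
  (¬ (((2 : Fin 8) ∈ A ∧ (2 : Fin 8) ∈ B) ∧ ((5 : Fin 8) ∈ A ∧ (5 : Fin 8) ∈ B)) ∧ (¬ (((3 : Fin 8) ∈ A ∧ (3 : Fin 8) ∈ B) ∧ ((4 : Fin 8) ∈ A ∧ (4 : Fin 8) ∈ B)) ∧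
  (¬ (((3 : Fin 8) ∈ A ∧ (3 : Fin 8) ∈ B) ∧ ((5 : Fin 8) ∈ A ∧ (5 : Fin 8) ∈ B)) ∧
   ¬ (((4 : Fin 8) ∈ A ∧ (4 : Fin 8) ∈ B) ∧ ((5 : Fin 8) ∈ A ∧ (5 : Fin 8) ∈ B))))))))))))

open Classical in
/-- Real leaf of the event sum as a function of the red and blue edge sets. -/
noncomputable def LEAF₆ (R B : Finset (Fin 9)) : ℝ :=
  (if condP (openCluster (ends₆ '' (↑R : Set (Fin 9))) 0) (openCluster (ends₆ '' (↑B : Set (Fin 9))) 0) then (1 : ℝ) else 0) *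
    ((pt 6 (openCluster (ends₆ '' (↑R : Set (Fin 9))) 0) - pt 6 (openCluster (ends₆ '' (↑B : Set (Fin 9))) 0)) *
      (pt 7 (openCluster (ends₆ '' (↑R : Set (Fin 9))) 0) - pt 7 (openCluster (ends₆ '' (↑B : Set (Fin 9))) 0)))

/-- Boolean form of the event predicate. [folklore] -/
theorem bool_cond {A B : Set (Fin 8)} {a b : ℕ → Bool} (ha : ∀ v : Fin 8, v ∈ A ↔ a v = true) (hb : ∀ v : Fin 8, v ∈ B ↔ b v = true) :
    condP A B ↔ condB (fun v => a v && b v) = true := by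
  simp only [condP, condB, ha, hb, Bool.and_eq_true, Bool.not_eq_true', Bool.eq_false_iff, ne_eq]
  norm_num

open Classical in
/-- The integer leaf computes the real leaf of the witness. -/
theorem HL₆ : ∀ (R B : Finset (Fin 9)) (labR labB : List ℕ),
    (∃ op : List (ℕ × ℕ), cfgOf 8 op = endsOf EL₆ hEL₆ '' (↑R : Set (Fin 9)) ∧ LabelsOK 8 op labR) →
    (∃ op : List (ℕ × ℕ), cfgOf 8 op = endsOf EL₆ hEL₆ '' (↑B : Set (Fin 9)) ∧ LabelsOK 8 op labB) →
    (leaf₆ labR labB : ℝ) = LEAF₆ R B := by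
  intro R B labR labB hR hB
  rw [leaf₆, leafB_cast, LEAF₆, ends₆,
    ite_eq_of_iff (bool_cond (fun v => mem_iff_of_inv hR 0 v) (fun v => mem_iff_of_inv hB 0 v)),
    pt_eq_of_iff (mem_iff_of_inv hR 0 6), pt_eq_of_iff (mem_iff_of_inv hB 0 6), pt_eq_of_iff (mem_iff_of_inv hR 0 7), pt_eq_of_iff (mem_iff_of_inv hB 0 7)]
  rfl

open Classical in
/-- **The NC-DOWN event sum of the witness is `−2`**: over the colourings `s` in the event "`6, 7` not in the core, at most one of `1,…,5` in the core"
(`E` = all nine edges), `Σ (pt 6 (K s) − pt 6 (K(E∖s)))·(pt 7 (K s) − pt 7 (K(E∖s))) = −2`. -/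
theorem ncDown_sum_eq :
    (∑ s ∈ (univ : Finset (Fin 9)).powerset.filter (fun s : Finset (Fin 9) => condP (K₆ s) (K₆ (univ \ s))),
      (pt 6 (K₆ s) - pt 6 (K₆ (univ \ s))) * (pt 7 (K₆ s) - pt 7 (K₆ (univ \ s)))) = -2 := by
  have hbridge := cwRec_eq_sum EL₆ hEL₆ leaf₆ LEAF₆ HL₆ lE₆ (by decide) ∅ ∅ _ _ (inv_empty EL₆ hEL₆) (inv_empty EL₆ hEL₆)
  have hl : lE₆.toFinset = (univ : Finset (Fin 9)) := by decide
  rw [hl, cwRec₆] at hbridge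
  rw [Finset.sum_filter]
  have hsum : ∀ s ∈ (univ : Finset (Fin 9)).powerset,
      (if condP (K₆ s) (K₆ (univ \ s)) then (pt 6 (K₆ s) - pt 6 (K₆ (univ \ s))) * (pt 7 (K₆ s) - pt 7 (K₆ (univ \ s))) else 0) =
        LEAF₆ (∅ ∪ s) (∅ ∪ (univ \ s)) := by
    intro s _
    by_cases hc : condP (K₆ s) (K₆ (univ \ s))
    · rw [if_pos hc]
      simp only [K₆] at hc ⊢
      simp only [Finset.empty_union, LEAF₆, if_pos hc, one_mul]
    · rw [if_neg hc]
      simp only [K₆] at hc ⊢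
      simp only [Finset.empty_union, LEAF₆, if_neg hc, zero_mul]
  rw [Finset.sum_congr rfl hsum, ← hbridge]
  norm_num

open Classical in
/-- **NC-DOWN is false**: it is not the case that for every predicate `D` on (footprint, core) antitone in both arguments and all monotone `f, g` the two-colouring
sum restricted to `{s : D (K s ∪ K(E∖s)) (K s ∩ K(E∖s))}` is nonnegative (witness: the event above, `f = pt 6`, `g = pt 7`, sum `−2`). -/
theorem not_ncDown :
    ¬ (∀ (D : Set (Fin 8) → Set (Fin 8) → Prop), (∀ M Z M' Z', D M Z → M' ⊆ M → Z' ⊆ Z → D M' Z') →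
      ∀ (f g : Set (Fin 8) → ℝ), Monotone f → Monotone g →
      0 ≤ ∑ s ∈ (univ : Finset (Fin 9)).powerset.filter (fun s : Finset (Fin 9) => D (K₆ s ∪ K₆ (univ \ s)) (K₆ s ∩ K₆ (univ \ s))),
        (f (K₆ s) - f (K₆ (univ \ s))) * (g (K₆ s) - g (K₆ (univ \ s)))) := by
  intro h
  -- the event as an antitone predicate of the core alone
  have hanti : ∀ M Z M' Z' : Set (Fin 8), condP Z Z → M' ⊆ M → Z' ⊆ Z → condP Z' Z' := by
    intro M Z M' Z' hc _ hZ
    simp only [condP] at hc ⊢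
    obtain ⟨h6, h7, h12, h13, h14, h15, h23, h24, h25, h34, h35, h45⟩ := hc
    exact ⟨fun p => h6 ⟨hZ p.1, hZ p.2⟩, fun p => h7 ⟨hZ p.1, hZ p.2⟩,
      fun p => h12 ⟨⟨hZ p.1.1, hZ p.1.2⟩, ⟨hZ p.2.1, hZ p.2.2⟩⟩, fun p => h13 ⟨⟨hZ p.1.1, hZ p.1.2⟩, ⟨hZ p.2.1, hZ p.2.2⟩⟩,
      fun p => h14 ⟨⟨hZ p.1.1, hZ p.1.2⟩, ⟨hZ p.2.1, hZ p.2.2⟩⟩, fun p => h15 ⟨⟨hZ p.1.1, hZ p.1.2⟩, ⟨hZ p.2.1, hZ p.2.2⟩⟩,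
      fun p => h23 ⟨⟨hZ p.1.1, hZ p.1.2⟩, ⟨hZ p.2.1, hZ p.2.2⟩⟩, fun p => h24 ⟨⟨hZ p.1.1, hZ p.1.2⟩, ⟨hZ p.2.1, hZ p.2.2⟩⟩,
      fun p => h25 ⟨⟨hZ p.1.1, hZ p.1.2⟩, ⟨hZ p.2.1, hZ p.2.2⟩⟩, fun p => h34 ⟨⟨hZ p.1.1, hZ p.1.2⟩, ⟨hZ p.2.1, hZ p.2.2⟩⟩,
      fun p => h35 ⟨⟨hZ p.1.1, hZ p.1.2⟩, ⟨hZ p.2.1, hZ p.2.2⟩⟩, fun p => h45 ⟨⟨hZ p.1.1, hZ p.1.2⟩, ⟨hZ p.2.1, hZ p.2.2⟩⟩⟩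
  have h0 := h (fun _ Z => condP Z Z) hanti (pt 6) (pt 7) (pt_monotone 6) (pt_monotone 7)
  -- the two event descriptions agree: `v ∈ Z ∧ v ∈ Z` with `Z = K ∩ B` versus `v ∈ K ∧ v ∈ B`
  have hcongr : ∀ s ∈ (univ : Finset (Fin 9)).powerset,
      condP (K₆ s ∩ K₆ (univ \ s)) (K₆ s ∩ K₆ (univ \ s)) ↔ condP (K₆ s) (K₆ (univ \ s)) := by
    intro s _
    simp only [condP, Set.mem_inter_iff, and_self]
  rw [Finset.filter_congr hcongr, ncDown_sum_eq] at h0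
  linarith

end NCDownCex

end Coefficientwise

end Summit.CriticalPhenomena.PercolationContinuityZ3.Theorems
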